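import Literature.NumberTheory.QuadraticFields.ReducedForms
import Literature.NumberTheory.QuadraticFields.LenstraPomeranceCoprimePairs
import Mathlib.RingTheory.Coprime.Lemmas
import Mathlib.Tactic
import HarnessLib

/-!
# Ambiguous reduced forms: the three shapes `(a, 0, c)`, `(a, a, c)`, `(a, b, a)`

H. W. Lenstra Jr. and C. Pomerance, *A rigorous time bound for factoring integers*,
J. Amer. Math. Soc. **5** (1992) 483–516, §2, (2.4) and Theorem 2.5 (pp. 487–488). A reduced
primitive positive definite form `(a, b, c)` of discriminant `Δ < 0` is *ambiguous* (its class has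
order dividing `2`) iff `b = 0` or `b = a` or `a = c` [LP92 (2.4)]. This file sets up the
elementary bijections behind the count of Theorem 2.5 (file `LenstraPomeranceAmbiguousForms`):

* `(a, 0, c)` ↔ coprime factorizations `(|Δ|/4) = a·c` with `a ≤ c`
  (`card_filter_b_eq_zero`);
* `(a, a, c)` (reduced, `a ≤ c`) and `(a, b, a)` with `0 < b < a` ↔ the pairs `(A, C)` of positive
  integers with `A(4C - A) = |Δ|`, `gcd(A, C) = 1`, `A < 2C`, split by `A ≤ C` / `C < A`
  (`card_filter_b_eq_a`, `card_filter_a_eq_c`: the form `(a, b, a)` corresponds to the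
  non-reduced form `(2a - b, 2a - b, a)` of the same shape);
* the ambiguous reduced forms are the disjoint union of the three shapes
  (`card_filter_ambiguous_eq_add`).

Forms are the triples `(a, b, c) : ℤ × ℤ × ℤ` of `ReducedForms.lean` (`reducedForms Δ`,
`mem_reducedForms_iff`). Everything is proved; no definitions, no named facts.
-/

namespace Literature.NumberTheory.QuadraticFields.BinaryQuadraticForm

open Finset

/-! ### Primitivity of the three shapes -/

/-- `IsPrimitive (a, b, c)` in terms of `Nat.gcd` of absolute values. [folklore] -/
theorem isPrimitive_iff_natAbs (a b c : ℤ) :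
    IsPrimitive (a, b, c) ↔ Nat.gcd (Nat.gcd a.natAbs b.natAbs) c.natAbs = 1 := by
  rw [isPrimitive_iff, Int.gcd_eq_natAbs, Int.gcd_eq_natAbs, Int.natAbs_natCast]

/-- `(a, 0, c)` is primitive iff `gcd(a, c) = 1`. [folklore] -/
theorem isPrimitive_zero_iff (a c : ℤ) :
    IsPrimitive (a, 0, c) ↔ Nat.Coprime a.natAbs c.natAbs := by
  rw [isPrimitive_iff_natAbs, Int.natAbs_zero, Nat.gcd_zero_right, Nat.Coprime]

/-- `(a, a, c)` is primitive iff `gcd(a, c) = 1`. [folklore] -/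
theorem isPrimitive_diag_iff (a c : ℤ) :
    IsPrimitive (a, a, c) ↔ Nat.Coprime a.natAbs c.natAbs := by
  rw [isPrimitive_iff_natAbs, Nat.gcd_self, Nat.Coprime]

/-- `(a, b, a)` is primitive iff `gcd(a, b) = 1`. [folklore] -/
theorem isPrimitive_outer_iff (a b : ℤ) :
    IsPrimitive (a, b, a) ↔ Nat.Coprime a.natAbs b.natAbs := by
  rw [isPrimitive_iff_natAbs, Nat.gcd_comm, ← Nat.gcd_assoc, Nat.gcd_self, Nat.Coprime]

/-- `Nat.Coprime |m| |n| ↔ IsCoprime m n` for integers. [folklore] -/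
theorem coprime_natAbs_iff_isCoprime (m n : ℤ) :
    Nat.Coprime m.natAbs n.natAbs ↔ IsCoprime m n := by
  rw [Int.isCoprime_iff_gcd_eq_one, Int.gcd_eq_natAbs, Nat.Coprime]

/-! ### The shape `(a, 0, c)` -/

/-- A reduced form `(a, 0, c)` has `4 ∣ Δ`; so for `4 ∤ Δ` there is none. [folklore] -/
theorem card_filter_b_eq_zero_of_not_dvd {Δ : ℤ} (hΔ : Δ < 0) (h4 : ¬ (4 : ℤ) ∣ Δ) :
    #{Q ∈ reducedForms Δ | Q.2.1 = 0} = 0 := by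
  rw [Finset.card_eq_zero, Finset.filter_eq_empty_iff]
  rintro ⟨a, b, c⟩ hQ hb
  simp only at hb
  subst hb
  obtain ⟨hdisc, -, -, -⟩ := (mem_reducedForms_iff hΔ).1 hQ
  rw [discr_apply] at hdisc
  exact h4 ⟨-(a * c), by rw [← hdisc]; ring⟩

/-- **The shape `(a, 0, c)` ↔ coprime factorizations `|Δ|/4 = a c`, `a ≤ c`** (`4 ∣ Δ`):
`(a, 0, c) ↦ (a, c)`. [cite: LenstraPomerance1992, §2 (2.4) and Theorem 2.5] -/
theorem card_filter_b_eq_zero {Δ : ℤ} (hΔ : Δ < 0) (h4 : (4 : ℤ) ∣ Δ) :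
    #{Q ∈ reducedForms Δ | Q.2.1 = 0} =
      #{x ∈ (Δ.natAbs / 4).divisorsAntidiagonal | Nat.Coprime x.1 x.2 ∧ x.1 ≤ x.2} := by
  obtain ⟨k, hk⟩ := h4
  set M := Δ.natAbs / 4 with hM
  have hMk : (M : ℤ) = -k := by
    have h1 : Δ.natAbs = 4 * k.natAbs := by rw [hk, Int.natAbs_mul]; rfl
    rw [hM, h1, Nat.mul_div_cancel_left _ (by norm_num : 0 < 4)]
    exact Int.ofNat_natAbs_of_nonpos (by omega)
  have hM0 : M ≠ 0 := by
    intro h0; rw [h0] at hMk; push_cast at hMk; omega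
  refine Finset.card_nbij' (fun Q => (Q.1.natAbs, Q.2.2.natAbs)) (fun x => ((x.1 : ℤ), 0, (x.2 : ℤ)))
    ?_ ?_ ?_ ?_
  · rintro ⟨a, b, c⟩ hQ
    rw [Finset.mem_coe, Finset.mem_filter] at hQ
    obtain ⟨hQ, hb⟩ := hQ
    simp only at hb
    subst hb
    obtain ⟨hdisc, ha, hprim, hred⟩ := (mem_reducedForms_iff hΔ).1 hQ
    obtain ⟨-, -, -, hac⟩ := le_of_isReduced hdisc ha hred
    simp only at ha hac
    rw [discr_apply] at hdisc
    rw [isPrimitive_zero_iff] at hprim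
    have hacM : a * c = M := by
      have : 4 * (a * c) = 4 * M := by rw [hMk]; linear_combination -hdisc - hk
      omega
    rw [Finset.mem_coe, Finset.mem_filter, Nat.mem_divisorsAntidiagonal]
    refine ⟨⟨?_, hM0⟩, hprim, ?_⟩
    · zify
      rw [abs_of_pos ha, abs_of_pos (by omega), hacM]
    · simp only
      omega
  · rintro ⟨d₀, d₁⟩ hx
    rw [Finset.mem_coe, Finset.mem_filter, Nat.mem_divisorsAntidiagonal] at hx
    obtain ⟨⟨hprod, -⟩, hcop, hle⟩ := hx
    simp only at hprod hcop hle
    have hd₀ : d₀ ≠ 0 := left_ne_zero_of_mul (hprod ▸ hM0)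
    rw [Finset.mem_coe, Finset.mem_filter, mem_reducedForms_iff hΔ]
    refine ⟨⟨?_, ?_, ?_, ?_⟩, rfl⟩
    · rw [discr_apply]
      have : ((d₀ : ℕ) : ℤ) * d₁ = M := by exact_mod_cast hprod
      linear_combination (-4) * this - 4 * hMk - hk
    · simp only; omega
    · rw [isPrimitive_zero_iff]
      simpa only [Int.natAbs_natCast] using hcop
    · refine ⟨by simp only; omega, by simp only; omega, by simp only; exact_mod_cast hle, ?_⟩
      simp only
      intro; rfl
  · rintro ⟨a, b, c⟩ hQ
    rw [Finset.mem_coe, Finset.mem_filter] at hQ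
    obtain ⟨hQ, hb⟩ := hQ
    simp only at hb
    subst hb
    obtain ⟨hdisc, ha, -, hred⟩ := (mem_reducedForms_iff hΔ).1 hQ
    obtain ⟨-, -, -, hac⟩ := le_of_isReduced hdisc ha hred
    simp only at ha hac ⊢
    rw [Int.natAbs_of_nonneg ha.le, Int.natAbs_of_nonneg (by omega)]
  · rintro ⟨d₀, d₁⟩ -
    simp only [Int.natAbs_natCast]

/-! ### The pairs `(A, C)` with `A(4C - A) = |Δ|`, `gcd(A, C) = 1`, `A < 2C` -/

/-- Membership in the pair set: the box bounds `1 ≤ A, C ≤ D` are automatic for `D > 0`.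
[folklore] -/
theorem mem_ambPairs_iff {D : ℕ} (hD : 0 < D) (x : ℕ × ℕ) :
    x ∈ {x ∈ Icc 1 D ×ˢ Icc 1 D | x.1 < 2 * x.2 ∧ x.1 * (4 * x.2 - x.1) = D ∧ Nat.Coprime x.1 x.2}
      ↔ x.1 < 2 * x.2 ∧ x.1 * (4 * x.2 - x.1) = D ∧ Nat.Coprime x.1 x.2 := by
  rw [Finset.mem_filter, Finset.mem_product, Finset.mem_Icc, Finset.mem_Icc]
  constructor
  · exact fun h => h.2
  · rintro ⟨hlt, heq, hcop⟩
    refine ⟨⟨⟨?_, ?_⟩, ?_, ?_⟩, hlt, heq, hcop⟩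
    · rcases Nat.eq_zero_or_pos x.1 with h0 | h0
      · rw [h0, zero_mul] at heq; omega
      · exact h0
    · have h1 : 0 < 4 * x.2 - x.1 := by
        rcases Nat.eq_zero_or_pos (4 * x.2 - x.1) with h0 | h0
        · rw [h0, mul_zero] at heq; omega
        · exact h0
      calc x.1 ≤ x.1 * (4 * x.2 - x.1) := Nat.le_mul_of_pos_right _ h1
        _ = D := heq
    · omega
    · have h0 : 0 < x.1 := by
        rcases Nat.eq_zero_or_pos x.1 with h0 | h0
        · rw [h0, zero_mul] at heq; omega
        · exact h0
      have h1 : 4 * x.2 - x.1 ≤ D := by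
        calc 4 * x.2 - x.1 ≤ x.1 * (4 * x.2 - x.1) := Nat.le_mul_of_pos_left _ h0
          _ = D := heq
      have h2 : x.1 ≤ D := by
        calc x.1 ≤ x.1 * (4 * x.2 - x.1) := Nat.le_mul_of_pos_right _ (by omega)
          _ = D := heq
      omega

/-- **The shape `(a, a, c)` ↔ the pairs `(A, C)` with `A ≤ C`**: `(a, a, c) ↦ (a, c)`
(`a(4c - a) = |Δ|`). [cite: LenstraPomerance1992, §2 (2.4) and Theorem 2.5] -/
theorem card_filter_b_eq_a {Δ : ℤ} (hΔ : Δ < 0) :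
    #{Q ∈ reducedForms Δ | Q.2.1 = Q.1} =
      #{x ∈ {x ∈ Icc 1 Δ.natAbs ×ˢ Icc 1 Δ.natAbs | x.1 < 2 * x.2 ∧
          x.1 * (4 * x.2 - x.1) = Δ.natAbs ∧ Nat.Coprime x.1 x.2} | x.1 ≤ x.2} := by
  set D := Δ.natAbs with hD
  have hDΔ : (D : ℤ) = -Δ := Int.ofNat_natAbs_of_nonpos hΔ.le
  have hD0 : 0 < D := by omega
  refine Finset.card_nbij' (fun Q => (Q.1.natAbs, Q.2.2.natAbs))
    (fun x => ((x.1 : ℤ), (x.1 : ℤ), (x.2 : ℤ))) ?_ ?_ ?_ ?_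
  · rintro ⟨a, b, c⟩ hQ
    rw [Finset.mem_coe, Finset.mem_filter] at hQ
    obtain ⟨hQ, hb⟩ := hQ
    simp only at hb
    subst b
    obtain ⟨hdisc, ha, hprim, hred⟩ := (mem_reducedForms_iff hΔ).1 hQ
    obtain ⟨-, -, -, hac⟩ := le_of_isReduced hdisc ha hred
    simp only at ha hac
    rw [discr_apply] at hdisc
    rw [isPrimitive_diag_iff] at hprim
    rw [Finset.mem_coe, Finset.mem_filter, mem_ambPairs_iff hD0]
    simp only
    have ha' : ((a.natAbs : ℕ) : ℤ) = a := Int.natAbs_of_nonneg ha.le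
    have hc' : ((c.natAbs : ℕ) : ℤ) = c := Int.natAbs_of_nonneg (by omega)
    refine ⟨⟨by omega, ?_, hprim⟩, by omega⟩
    have hle : a.natAbs ≤ 4 * c.natAbs := by omega
    zify [hle]
    rw [abs_of_pos ha, abs_of_pos (by omega : (0 : ℤ) < c), hDΔ, ← hdisc]
    ring
  · rintro ⟨A, C⟩ hx
    rw [Finset.mem_coe, Finset.mem_filter, mem_ambPairs_iff hD0] at hx
    obtain ⟨⟨hlt, heq, hcop⟩, hle⟩ := hx
    simp only at hlt heq hcop hle
    have hA0 : 0 < A := by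
      rcases Nat.eq_zero_or_pos A with h0 | h0
      · rw [h0, zero_mul] at heq; omega
      · exact h0
    have heqZ : (A : ℤ) * (4 * C - A) = D := by
      have hle' : A ≤ 4 * C := by omega
      exact_mod_cast heq
    rw [Finset.mem_coe, Finset.mem_filter, mem_reducedForms_iff hΔ]
    refine ⟨⟨?_, ?_, ?_, ?_⟩, rfl⟩
    · rw [discr_apply]
      linear_combination (-1 : ℤ) * heqZ - hDΔ
    · simp only; exact_mod_cast hA0
    · rw [isPrimitive_diag_iff]
      simpa only [Int.natAbs_natCast] using hcop
    · refine ⟨by simp only; omega, by simp only; omega, by simp only; exact_mod_cast hle, ?_⟩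
      simp only
      intro; positivity
  · rintro ⟨a, b, c⟩ hQ
    rw [Finset.mem_coe, Finset.mem_filter] at hQ
    obtain ⟨hQ, hb⟩ := hQ
    simp only at hb
    subst b
    obtain ⟨hdisc, ha, -, hred⟩ := (mem_reducedForms_iff hΔ).1 hQ
    obtain ⟨-, -, -, hac⟩ := le_of_isReduced hdisc ha hred
    simp only at ha hac ⊢
    rw [Int.natAbs_of_nonneg ha.le, Int.natAbs_of_nonneg (by omega)]
  · rintro ⟨A, C⟩ -
    simp only [Int.natAbs_natCast]

/-- **The shape `(a, b, a)`, `0 < b < a` ↔ the pairs `(A, C)` with `C < A`**: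
`(a, b, a) ↦ (2a - b, a)`, inverse `(A, C) ↦ (C, 2C - A, C)` (the form `(a, b, a)` is properly
equivalent to the non-reduced `(2a - b, 2a - b, a)`). [cite: LenstraPomerance1992, §2 (2.4) and Theorem 2.5] -/
theorem card_filter_a_eq_c {Δ : ℤ} (hΔ : Δ < 0) :
    #{Q ∈ reducedForms Δ | Q.1 = Q.2.2 ∧ 0 < Q.2.1 ∧ Q.2.1 < Q.1} =
      #{x ∈ {x ∈ Icc 1 Δ.natAbs ×ˢ Icc 1 Δ.natAbs | x.1 < 2 * x.2 ∧
          x.1 * (4 * x.2 - x.1) = Δ.natAbs ∧ Nat.Coprime x.1 x.2} | x.2 < x.1} := by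
  set D := Δ.natAbs with hD
  have hDΔ : (D : ℤ) = -Δ := Int.ofNat_natAbs_of_nonpos hΔ.le
  have hD0 : 0 < D := by omega
  refine Finset.card_nbij' (fun Q => ((2 * Q.1 - Q.2.1).natAbs, Q.1.natAbs))
    (fun x => ((x.2 : ℤ), 2 * (x.2 : ℤ) - x.1, (x.2 : ℤ))) ?_ ?_ ?_ ?_
  · rintro ⟨a, b, c⟩ hQ
    rw [Finset.mem_coe, Finset.mem_filter] at hQ
    obtain ⟨hQ, hac, hb0, hba⟩ := hQ
    simp only at hac hb0 hba
    subst hac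
    obtain ⟨hdisc, ha, hprim, -⟩ := (mem_reducedForms_iff hΔ).1 hQ
    simp only at ha
    rw [discr_apply] at hdisc
    rw [isPrimitive_outer_iff, coprime_natAbs_iff_isCoprime] at hprim
    rw [Finset.mem_coe, Finset.mem_filter, mem_ambPairs_iff hD0]
    simp only
    have ha' : ((a.natAbs : ℕ) : ℤ) = a := Int.natAbs_of_nonneg ha.le
    have hA' : (((2 * a - b).natAbs : ℕ) : ℤ) = 2 * a - b := Int.natAbs_of_nonneg (by omega)
    refine ⟨⟨by omega, ?_, ?_⟩, by omega⟩
    · have hle : (2 * a - b).natAbs ≤ 4 * a.natAbs := by omega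
      zify [hle]
      rw [abs_of_pos ha, abs_of_nonneg (by omega : (0 : ℤ) ≤ 2 * a - b), hDΔ, ← hdisc]
      ring
    · rw [coprime_natAbs_iff_isCoprime]
      obtain ⟨u, v, huv⟩ := hprim
      exact ⟨-v, u + 2 * v, by linear_combination huv⟩
  · rintro ⟨A, C⟩ hx
    rw [Finset.mem_coe, Finset.mem_filter, mem_ambPairs_iff hD0] at hx
    obtain ⟨⟨hlt, heq, hcop⟩, hCA⟩ := hx
    simp only at hlt heq hcop hCA
    have heqZ : (A : ℤ) * (4 * C - A) = D := by
      have hle' : A ≤ 4 * C := by omega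
      exact_mod_cast heq
    rw [Finset.mem_coe, Finset.mem_filter, mem_reducedForms_iff hΔ]
    refine ⟨⟨?_, ?_, ?_, ?_⟩, rfl, ?_, ?_⟩
    · rw [discr_apply]
      linear_combination (-1 : ℤ) * heqZ - hDΔ
    · simp only; omega
    · rw [isPrimitive_outer_iff, coprime_natAbs_iff_isCoprime]
      obtain ⟨u, v, huv⟩ := (coprime_natAbs_iff_isCoprime (A : ℤ) (C : ℤ)).1
        (by simpa only [Int.natAbs_natCast] using hcop)
      exact ⟨v + 2 * u, -u, by linear_combination huv⟩
    · refine ⟨by simp only; omega, by simp only; omega, by simp only; omega, ?_⟩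
      simp only
      intro; omega
    · simp only; omega
    · simp only; omega
  · rintro ⟨a, b, c⟩ hQ
    rw [Finset.mem_coe, Finset.mem_filter] at hQ
    obtain ⟨hQ, hac, hb0, hba⟩ := hQ
    simp only at hac hb0 hba
    subst hac
    obtain ⟨-, ha, -, -⟩ := (mem_reducedForms_iff hΔ).1 hQ
    simp only at ha ⊢
    rw [Int.natAbs_of_nonneg ha.le, Int.natAbs_of_nonneg (by omega)]
    ext
    · rfl
    · simp only; ring
    · rfl
  · rintro ⟨A, C⟩ hx
    rw [Finset.mem_coe, Finset.mem_filter, mem_ambPairs_iff hD0] at hx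
    obtain ⟨⟨hlt, -, -⟩, -⟩ := hx
    simp only at hlt ⊢
    ext
    · simp only; omega
    · simp only [Int.natAbs_natCast]

/-! ### Splitting the ambiguous reduced forms into the three shapes -/

/-- **The ambiguous reduced forms are the disjoint union of the three shapes**: for `Δ < 0`,
`#{b = 0 ∨ b = a ∨ a = c} = #{b = 0} + #{b = a} + #{a = c, 0 < b < a}` (a reduced form with
`a = c` has `0 ≤ b ≤ a`). [cite: LenstraPomerance1992, §2 (2.4)] -/
theorem card_filter_ambiguous_eq_add {Δ : ℤ} (hΔ : Δ < 0) :
    #{Q ∈ reducedForms Δ | Q.2.1 = 0 ∨ Q.2.1 = Q.1 ∨ Q.1 = Q.2.2} =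
      #{Q ∈ reducedForms Δ | Q.2.1 = 0} + #{Q ∈ reducedForms Δ | Q.2.1 = Q.1} +
        #{Q ∈ reducedForms Δ | Q.1 = Q.2.2 ∧ 0 < Q.2.1 ∧ Q.2.1 < Q.1} := by
  rw [← Finset.card_union_of_disjoint, ← Finset.card_union_of_disjoint]
  · congr 1
    ext ⟨a, b, c⟩
    simp only [Finset.mem_union, Finset.mem_filter]
    constructor
    · rintro ⟨hQ, h⟩
      obtain ⟨-, ha, -, hred⟩ := (mem_reducedForms_iff hΔ).1 hQ
      obtain ⟨h1, h2, h3, h4⟩ := hred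
      simp only at ha h1 h2 h3 h4 h ⊢
      rcases h with h | h | h
      · exact Or.inl (Or.inl ⟨hQ, h⟩)
      · exact Or.inl (Or.inr ⟨hQ, h⟩)
      · have hb : 0 ≤ b := h4 (Or.inr (Or.inr h))
        rcases hb.lt_or_eq with hb | hb
        · rcases (lt_or_eq_of_le h2) with hb' | hb'
          · exact Or.inr ⟨hQ, h, hb, hb'⟩
          · exact Or.inl (Or.inr ⟨hQ, hb'⟩)
        · exact Or.inl (Or.inl ⟨hQ, hb.symm⟩)
    · rintro ((⟨hQ, h⟩ | ⟨hQ, h⟩) | ⟨hQ, h, -, -⟩)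
      · exact ⟨hQ, Or.inl h⟩
      · exact ⟨hQ, Or.inr (Or.inl h)⟩
      · exact ⟨hQ, Or.inr (Or.inr h)⟩
  · rw [Finset.disjoint_left]
    rintro ⟨a, b, c⟩ h1 h2
    simp only [Finset.mem_union, Finset.mem_filter] at h1 h2
    obtain ⟨hQ, hac, hb0, hba⟩ := h2
    obtain ⟨-, ha, -, -⟩ := (mem_reducedForms_iff hΔ).1 hQ
    simp only at ha hac hb0 hba
    rcases h1 with ⟨-, h⟩ | ⟨-, h⟩
    · omega
    · omega
  · rw [Finset.disjoint_left]
    rintro ⟨a, b, c⟩ h1 h2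
    simp only [Finset.mem_filter] at h1 h2
    obtain ⟨hQ, hb⟩ := h1
    obtain ⟨-, hba⟩ := h2
    obtain ⟨-, ha, -, -⟩ := (mem_reducedForms_iff hΔ).1 hQ
    simp only at ha hb hba
    omega

/-- The two halves `A ≤ C` and `C < A` of the pair set add up. [folklore] -/
theorem card_ambPairs_split (D : ℕ) :
    #{x ∈ {x ∈ Icc 1 D ×ˢ Icc 1 D | x.1 < 2 * x.2 ∧ x.1 * (4 * x.2 - x.1) = D ∧
        Nat.Coprime x.1 x.2} | x.1 ≤ x.2} +
      #{x ∈ {x ∈ Icc 1 D ×ˢ Icc 1 D | x.1 < 2 * x.2 ∧ x.1 * (4 * x.2 - x.1) = D ∧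
        Nat.Coprime x.1 x.2} | x.2 < x.1} =
      #{x ∈ Icc 1 D ×ˢ Icc 1 D | x.1 < 2 * x.2 ∧ x.1 * (4 * x.2 - x.1) = D ∧
        Nat.Coprime x.1 x.2} := by
  have h := Finset.card_filter_add_card_filter_not
    (s := {x ∈ Icc 1 D ×ˢ Icc 1 D | x.1 < 2 * x.2 ∧ x.1 * (4 * x.2 - x.1) = D ∧
        Nat.Coprime x.1 x.2}) (fun x : ℕ × ℕ => x.1 ≤ x.2)
  rw [← h]
  congr 2
  exact Finset.filter_congr fun x _ => by simp only [not_le]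

/-- **Ambiguous reduced forms = shape `(a, 0, c)` + the pair set.** For `Δ < 0`:
`#{Q reduced : b = 0 ∨ b = a ∨ a = c} = #{b = 0} + #{(A, C) : A(4C-A) = |Δ|, gcd(A,C) = 1, A < 2C}`.
[cite: LenstraPomerance1992, §2 (2.4) and Theorem 2.5] -/
theorem card_filter_ambiguous_eq {Δ : ℤ} (hΔ : Δ < 0) :
    #{Q ∈ reducedForms Δ | Q.2.1 = 0 ∨ Q.2.1 = Q.1 ∨ Q.1 = Q.2.2} =
      #{Q ∈ reducedForms Δ | Q.2.1 = 0} +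
        #{x ∈ Icc 1 Δ.natAbs ×ˢ Icc 1 Δ.natAbs | x.1 < 2 * x.2 ∧
          x.1 * (4 * x.2 - x.1) = Δ.natAbs ∧ Nat.Coprime x.1 x.2} := by
  rw [card_filter_ambiguous_eq_add hΔ, card_filter_b_eq_a hΔ, card_filter_a_eq_c hΔ, add_assoc,
    card_ambPairs_split]

end Literature.NumberTheory.QuadraticFields.BinaryQuadraticForm
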